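import Summits.CriticalPhenomena.PercolationContinuityZ3.Theorems.PercNearOneGluingNoHeavyLowerTailSunflowerLocalAssignmentExact
import Summits.CriticalPhenomena.PercolationContinuityZ3.Theorems.PercNearOneGluingNoHeavyLowerTailSunflowerDownReaderExact
import HarnessLib
import HarnessLib.Audit

/-!
# `NoHeavyLowerTail` (crux stmt-CriticalPhenomena-4575), abstract sunflower cubic: the TWO-SIDED local assignment theorem — junk-free bottom
# slots (exact up-reader) and co-junk-free KERNEL slots (exact down-reader)

Support file (seat `prim-l12-p2` gen 24; `--supports stmt-CriticalPhenomena-4575`).  No `sorry`, no new definitions.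
Memo: run/shared/lean/prim/prim-l12/prim-l12-p2/FINDING-g24-LOCAL-ASSIGNMENT.md (§3, §5(1)).
* `Sunflower.rbVec_pair_kernel_raw` — pairing of an arbitrary `N`-functional `col_Z` with `rbVec ρ` at a kernel block `K`
  (`= [TS-A condition]·n_ρ(K)·Σ_O col_Z(Kᶜ∖O)·μ_{Q3}(O)`; mirror of `rbVec_pair_bottom_raw`).
* `Sunflower.blockIndependent_of_cojunkFree` — at a kernel block `K`, rainbows with distinct `Q3`, each having `K` as a kernel slot
  (`Q1 ⊆ K ⊆ Q1 ∪ Q2`, `lab (Kᶜ∖Q3) = 0`, `#{R ∈ A : Q1 ⊆ R ⊆ K}` odd) and with vanishing mutual down-reader junk, are independent there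
  (the down-reader of the `|Q3|`-MINIMAL member of a dependency isolates it).
* **`Sunflower.ZH_nonneg_of_biJunkFreeAssignment`** — ★ for every sunflower whose rainbows can be assigned to junk-free bottom slots (distinct `Q1`
  per block) and co-junk-free kernel slots (distinct `Q3` per block).  With `…LocalAssignment` (private supplies) and `…LocalAssignmentExact`
  this completes the symmetric sufficient criteria for `LocalRainbowAssignment` (`…SunflowerLocalPartition`); kernel blocks host ≥ 2 rainbows in
  ≈ 0.1 % of the census instances only (memo §1), so the gain is completeness rather than coverage.
-/

namespace Summit.CriticalPhenomena.PercolationContinuityZ3.Theorems.SunflowerPartition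

open Finset

variable {α : Type*} [Fintype α] [DecidableEq α]

namespace Sunflower

variable (F : Sunflower α)

/-- **Raw pairing of an arbitrary `N`-functional with `rbVec` at a kernel block** (this work): for a rainbow `ρ`, a kernel set `K` and ANY `Z ⊆ Kᶜ`,
`Σ_σ [σ.2 = K]·#{R ∈ A : Z ⊆ R ⊆ σ.1}·rbVec ρ σ = [TS-A condition of ρ at K]·n_ρ(K)·Σ_{O ⊆ Kᶜ} col_Z(Kᶜ∖O)·μ_{Q3}(O)`
(the kernel-block mirror of `rbVec_pair_bottom_raw`). [this work] -/
theorem rbVec_pair_kernel_raw {ρ : Finset α × Finset α} (hρ : ρ ∈ F.dem) (hr : F.IsRainbow ρ) {K Z : Finset α}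
    (hK4 : F.lab K = 4) (hZ : Z ⊆ Kᶜ) :
    (∑ σ ∈ F.sup, (if σ.2 = K then
        (∑ R ∈ (Kᶜ).powerset, (if F.lab R = 4 ∧ Z ⊆ R ∧ R ⊆ σ.1 then (1 : ZMod 2) else 0)) * F.rbVec ρ σ else 0))
      = if F.lab K = 4 ∧ ρ.1 ⊆ K ∧ (ρ.1 ∪ ρ.2)ᶜ ⊆ Kᶜ ∧ F.lab (Kᶜ \ (ρ.1 ∪ ρ.2)ᶜ) = 0 then
          (∑ R ∈ (Finset.univ : Finset α).powerset, (if F.lab R = 4 ∧ ρ.1 ⊆ R ∧ R ⊆ K then (1 : ZMod 2) else 0)) *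
          (∑ O ∈ (Kᶜ).powerset,
            (∑ R ∈ (Kᶜ).powerset, (if F.lab R = 4 ∧ Z ⊆ R ∧ R ⊆ Kᶜ \ O then (1 : ZMod 2) else 0)) *
            (∑ R' ∈ (Kᶜ).powerset, (if F.lab R' = 0 ∧ O ⊆ R' ∧ R' ⊆ (ρ.1 ∪ ρ.2)ᶜ then (1 : ZMod 2) else 0)))
        else 0 := by
  have _hZ := hZ
  have _hρ := hρ
  have _hr := hr
  rw [F.sum_sup_spectator K (Or.inl hK4)]
  by_cases hcond : F.lab K = 4 ∧ ρ.1 ⊆ K ∧ (ρ.1 ∪ ρ.2)ᶜ ⊆ Kᶜ ∧ F.lab (Kᶜ \ (ρ.1 ∪ ρ.2)ᶜ) = 0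
  · rw [if_pos hcond]
    have hsplit : (∑ O ∈ (Kᶜ).powerset,
            (∑ R ∈ (Kᶜ).powerset, (if F.lab R = 4 ∧ Z ⊆ R ∧ R ⊆ Kᶜ \ O then (1 : ZMod 2) else 0)) *
            (∑ R' ∈ (Kᶜ).powerset, (if F.lab R' = 0 ∧ O ⊆ R' ∧ R' ⊆ (ρ.1 ∪ ρ.2)ᶜ then (1 : ZMod 2) else 0)))
        = ∑ O ∈ (Kᶜ).powerset.filter (fun O => F.lab O = 0 ∧ F.lab (Kᶜ \ O) = 4),
            (∑ R ∈ (Kᶜ).powerset, (if F.lab R = 4 ∧ Z ⊆ R ∧ R ⊆ Kᶜ \ O then (1 : ZMod 2) else 0)) *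
            (∑ R' ∈ (Kᶜ).powerset, (if F.lab R' = 0 ∧ O ⊆ R' ∧ R' ⊆ (ρ.1 ∪ ρ.2)ᶜ then (1 : ZMod 2) else 0)) := by
      rw [← Finset.sum_filter_add_sum_filter_not (Kᶜ).powerset (fun O => F.lab O = 0 ∧ F.lab (Kᶜ \ O) = 4)]
      rw [show (∑ O ∈ (Kᶜ).powerset.filter (fun O => ¬ (F.lab O = 0 ∧ F.lab (Kᶜ \ O) = 4)),
            (∑ R ∈ (Kᶜ).powerset, (if F.lab R = 4 ∧ Z ⊆ R ∧ R ⊆ Kᶜ \ O then (1 : ZMod 2) else 0)) *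
            (∑ R' ∈ (Kᶜ).powerset, (if F.lab R' = 0 ∧ O ⊆ R' ∧ R' ⊆ (ρ.1 ∪ ρ.2)ᶜ then (1 : ZMod 2) else 0))) = 0 from
          sum_eq_zero fun O hO => by
            have hO' := (mem_filter.1 hO).2
            by_cases h0 : F.lab O = 0
            · have h4 : F.lab (Kᶜ \ O) ≠ 4 := fun h => hO' ⟨h0, h⟩
              rw [show (∑ R ∈ (Kᶜ).powerset, (if F.lab R = 4 ∧ Z ⊆ R ∧ R ⊆ Kᶜ \ O then (1 : ZMod 2) else 0)) = 0 from
                sum_eq_zero fun R _ => if_neg fun h' => h4 (F.lab_eq_four_of_subset h'.2.2 h'.1), zero_mul]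
            · rw [show (∑ R' ∈ (Kᶜ).powerset, (if F.lab R' = 0 ∧ O ⊆ R' ∧ R' ⊆ (ρ.1 ∪ ρ.2)ᶜ then (1 : ZMod 2) else 0)) = 0 from
                sum_eq_zero fun R' _ => if_neg fun h' => h0 (F.lab_eq_zero_of_subset h'.2.1 h'.1), mul_zero], add_zero]
    rw [hsplit, Finset.mul_sum]
    refine sum_congr rfl fun O hO => ?_
    have hOW : O ⊆ Kᶜ := mem_powerset.1 (mem_filter.1 hO).1
    have h3 : ((Kᶜ \ O) ∪ K)ᶜ = O := third_of_mk hOW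
    unfold rbVec
    simp only
    rw [h3, if_neg (fun h => by rw [hK4] at h; exact absurd h.1 (by decide)), zero_add, if_pos hcond]
    ring
  · rw [if_neg hcond]
    refine sum_eq_zero fun O _ => ?_
    unfold rbVec
    simp only
    rw [if_neg (fun h => by rw [hK4] at h; exact absurd h.1 (by decide)), zero_add, if_neg hcond, mul_zero]

/-- **CO-JUNK-FREE KERNEL SLOTS** (this work).  Let `lab K = 4` and let `R` be a set of rainbows `ρ = (Q1,Q2,Q3)` with pairwise distinct `Q3`, each
having `K` as a KERNEL SLOT — `Q1 ⊆ K ⊆ Q1 ∪ Q2`, `lab (Kᶜ ∖ Q3) = 0`, `#{R ∈ A : Q1 ⊆ R ⊆ K}` odd — such that the junk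
`J*_{Kᶜ}(Q3ρ, Q3ρ')` of the exact down-reader vanishes for all `ρ, ρ' ∈ R`.  Then the vectors `rbVec ρ`, `ρ ∈ R`, restricted to the supplies with
spectator `K`, are linearly independent (the down-reader `Λ*_{Q3ρ*}` of the `|Q3|`-MINIMAL member of a dependency isolates its coefficient). [this work] -/
theorem blockIndependent_of_cojunkFree {K : Finset α} (hK4 : F.lab K = 4) (R : Finset (Finset α × Finset α))
    (hR : R ⊆ F.dem.filter (fun d => F.IsRainbow d))
    (hslot : ∀ ρ ∈ R, ρ.1 ⊆ K ∧ (ρ.1 ∪ ρ.2)ᶜ ⊆ Kᶜ ∧ F.lab (Kᶜ \ (ρ.1 ∪ ρ.2)ᶜ) = 0 ∧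
      (∑ R' ∈ (Finset.univ : Finset α).powerset, (if F.lab R' = 4 ∧ ρ.1 ⊆ R' ∧ R' ⊆ K then (1 : ZMod 2) else 0)) = 1)
    (hjunk : ∀ ρ ∈ R, ∀ ρ' ∈ R,
      (∑ T ∈ (Kᶜ).powerset, (if F.lab T = 3 then
        (∑ R1 ∈ (Kᶜ).powerset, (if F.lab R1 = 0 ∧ R1 ⊆ (ρ.1 ∪ ρ.2)ᶜ ∧ Kᶜ \ T ⊆ R1 then (1 : ZMod 2) else 0)) *
        (∑ R2 ∈ (Kᶜ).powerset, (if F.lab R2 = 0 ∧ R2 ⊆ (ρ'.1 ∪ ρ'.2)ᶜ ∧ R2 ⊆ T then (1 : ZMod 2) else 0)) else 0)) = 0)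
    (hinj : ∀ ρ ∈ R, ∀ ρ' ∈ R, (ρ.1 ∪ ρ.2)ᶜ = (ρ'.1 ∪ ρ'.2)ᶜ → ρ = ρ') :
    LinearIndependent (ZMod 2) (fun ρ : ↥R => fun σ : ↥(F.sup.filter (fun σ => σ.2 = K)) => F.rbVec ρ.1 σ.1) := by
  classical
  rw [Fintype.linearIndependent_iff]
  intro g hg
  by_contra hne
  push Not at hne
  obtain ⟨i₀, hi₀⟩ := hne
  have rfacts : ∀ i : ↥R, i.1 ∈ F.dem ∧ F.IsRainbow i.1 := fun i => ⟨(mem_filter.1 (hR i.2)).1, (mem_filter.1 (hR i.2)).2⟩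
  have hsum : ∀ σ ∈ F.sup, σ.2 = K → (∑ i : ↥R, g i * F.rbVec i.1 σ) = 0 := by
    intro σ hσ hσS
    have h := congrFun hg ⟨σ, mem_filter.2 ⟨hσ, hσS⟩⟩
    simp only [Finset.sum_apply, Pi.smul_apply, smul_eq_mul, Pi.zero_apply] at h
    exact h
  obtain ⟨s, hsT, hmin⟩ := Finset.exists_min_image ((Finset.univ : Finset ↥R).filter (fun i => g i ≠ 0))
    (fun i : ↥R => ((i.1.1 ∪ i.1.2)ᶜ).card) ⟨i₀, mem_filter.2 ⟨mem_univ _, hi₀⟩⟩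
  have hgs : g s ≠ 0 := (mem_filter.1 hsT).2
  obtain ⟨hsK, hQs, hQs0, hPhi⟩ := hslot s.1 s.2
  set Q0 : Finset α := (s.1.1 ∪ s.1.2)ᶜ with hQ0def
  set J : ↥R → ZMod 2 := fun i => ∑ T ∈ (Kᶜ).powerset, (if F.lab T = 3 then
      (∑ R1 ∈ (Kᶜ).powerset, (if F.lab R1 = 0 ∧ R1 ⊆ Q0 ∧ Kᶜ \ T ⊆ R1 then (1 : ZMod 2) else 0)) *
      (∑ R2 ∈ (Kᶜ).powerset, (if F.lab R2 = 0 ∧ R2 ⊆ (i.1.1 ∪ i.1.2)ᶜ ∧ R2 ⊆ T then (1 : ZMod 2) else 0)) else 0) with hJ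
  have hJ0 : ∀ i : ↥R, J i = 0 := fun i => hjunk s.1 s.2 i.1 i.2
  -- per-rainbow reading of `Λ*_{Q3 s}` (raw pairing + exact down-reader)
  have hread : ∀ i : ↥R, (∑ Y ∈ Q0.powerset, (if F.lab Y = 0 then
      ∑ σ ∈ F.sup, (if σ.2 = K then
        (∑ R' ∈ (Kᶜ).powerset, (if F.lab R' = 4 ∧ Kᶜ \ Y ⊆ R' ∧ R' ⊆ σ.1 then (1 : ZMod 2) else 0)) * F.rbVec i.1 σ
        else 0) else 0))
      = (if F.lab K = 4 ∧ i.1.1 ⊆ K ∧ (i.1.1 ∪ i.1.2)ᶜ ⊆ Kᶜ ∧ F.lab (Kᶜ \ (i.1.1 ∪ i.1.2)ᶜ) = 0 then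
          (∑ R' ∈ (Finset.univ : Finset α).powerset, (if F.lab R' = 4 ∧ i.1.1 ⊆ R' ∧ R' ⊆ K then (1 : ZMod 2) else 0))
          else 0) * ((if (i.1.1 ∪ i.1.2)ᶜ ⊆ Q0 then 1 else 0) + J i) := by
    intro i
    obtain ⟨hid, hir⟩ := rfacts i
    by_cases hc : F.lab K = 4 ∧ i.1.1 ⊆ K ∧ (i.1.1 ∪ i.1.2)ᶜ ⊆ Kᶜ ∧ F.lab (Kᶜ \ (i.1.1 ∪ i.1.2)ᶜ) = 0
    · rw [if_pos hc]
      rw [hJ, ← F.mu_read_down_exact Kᶜ hQs hc.2.2.1 hQs0 (F.dem_rainbow_facts hid hir).2.2.2, Finset.mul_sum]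
      refine sum_congr rfl fun Y hY => ?_
      have hYS : Kᶜ \ Y ⊆ Kᶜ := sdiff_subset
      by_cases hY0 : F.lab Y = 0
      · rw [if_pos hY0, if_pos hY0, F.rbVec_pair_kernel_raw hid hir hK4 hYS, if_pos hc]
      · rw [if_neg hY0, if_neg hY0, mul_zero]
    · rw [if_neg hc, zero_mul]
      refine sum_eq_zero fun Y hY => ?_
      have hYS : Kᶜ \ Y ⊆ Kᶜ := sdiff_subset
      by_cases hY0 : F.lab Y = 0
      · rw [if_pos hY0, F.rbVec_pair_kernel_raw hid hir hK4 hYS, if_neg hc]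
      · rw [if_neg hY0]
  have hlin : ∀ Y, (∑ σ ∈ F.sup, (if σ.2 = K then
        (∑ R' ∈ (Kᶜ).powerset, (if F.lab R' = 4 ∧ Kᶜ \ Y ⊆ R' ∧ R' ⊆ σ.1 then (1 : ZMod 2) else 0)) *
          (∑ i : ↥R, g i * F.rbVec i.1 σ) else 0))
      = ∑ i : ↥R, g i * ∑ σ ∈ F.sup, (if σ.2 = K then
        (∑ R' ∈ (Kᶜ).powerset, (if F.lab R' = 4 ∧ Kᶜ \ Y ⊆ R' ∧ R' ⊆ σ.1 then (1 : ZMod 2) else 0)) * F.rbVec i.1 σ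
        else 0) := by
    intro Y
    rw [show (∑ i : ↥R, g i * ∑ σ ∈ F.sup, (if σ.2 = K then
          (∑ R' ∈ (Kᶜ).powerset, (if F.lab R' = 4 ∧ Kᶜ \ Y ⊆ R' ∧ R' ⊆ σ.1 then (1 : ZMod 2) else 0)) * F.rbVec i.1 σ
          else 0))
        = ∑ i : ↥R, ∑ σ ∈ F.sup, g i * (if σ.2 = K then
          (∑ R' ∈ (Kᶜ).powerset, (if F.lab R' = 4 ∧ Kᶜ \ Y ⊆ R' ∧ R' ⊆ σ.1 then (1 : ZMod 2) else 0)) * F.rbVec i.1 σ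
          else 0) from sum_congr rfl fun i _ => Finset.mul_sum _ _ _]
    rw [Finset.sum_comm]
    refine sum_congr rfl fun σ _ => ?_
    by_cases h : σ.2 = K
    · rw [if_pos h, Finset.mul_sum]
      refine sum_congr rfl fun i _ => ?_
      rw [if_pos h]; ring
    · rw [if_neg h]
      symm
      exact sum_eq_zero fun i _ => by rw [if_neg h, mul_zero]
  have hzero : (∑ i : ↥R, g i * ((if F.lab K = 4 ∧ i.1.1 ⊆ K ∧ (i.1.1 ∪ i.1.2)ᶜ ⊆ Kᶜ ∧ F.lab (Kᶜ \ (i.1.1 ∪ i.1.2)ᶜ) = 0 then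
          (∑ R' ∈ (Finset.univ : Finset α).powerset, (if F.lab R' = 4 ∧ i.1.1 ⊆ R' ∧ R' ⊆ K then (1 : ZMod 2) else 0))
          else 0) * ((if (i.1.1 ∪ i.1.2)ᶜ ⊆ Q0 then 1 else 0) + J i))) = 0 := by
    rw [show (∑ i : ↥R, g i * ((if F.lab K = 4 ∧ i.1.1 ⊆ K ∧ (i.1.1 ∪ i.1.2)ᶜ ⊆ Kᶜ ∧ F.lab (Kᶜ \ (i.1.1 ∪ i.1.2)ᶜ) = 0 then
          (∑ R' ∈ (Finset.univ : Finset α).powerset, (if F.lab R' = 4 ∧ i.1.1 ⊆ R' ∧ R' ⊆ K then (1 : ZMod 2) else 0))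
          else 0) * ((if (i.1.1 ∪ i.1.2)ᶜ ⊆ Q0 then 1 else 0) + J i)))
        = ∑ i : ↥R, ∑ Y ∈ Q0.powerset, g i * (if F.lab Y = 0 then
            ∑ σ ∈ F.sup, (if σ.2 = K then
              (∑ R' ∈ (Kᶜ).powerset, (if F.lab R' = 4 ∧ Kᶜ \ Y ⊆ R' ∧ R' ⊆ σ.1 then (1 : ZMod 2) else 0)) * F.rbVec i.1 σ
              else 0) else 0) from
      sum_congr rfl fun i _ => by rw [← hread i, Finset.mul_sum]]
    rw [Finset.sum_comm]
    refine sum_eq_zero fun Y _ => ?_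
    by_cases hY0 : F.lab Y = 0
    · rw [show (∑ i : ↥R, g i * (if F.lab Y = 0 then
            ∑ σ ∈ F.sup, (if σ.2 = K then
              (∑ R' ∈ (Kᶜ).powerset, (if F.lab R' = 4 ∧ Kᶜ \ Y ⊆ R' ∧ R' ⊆ σ.1 then (1 : ZMod 2) else 0)) * F.rbVec i.1 σ
              else 0) else 0))
          = ∑ i : ↥R, g i * ∑ σ ∈ F.sup, (if σ.2 = K then
              (∑ R' ∈ (Kᶜ).powerset, (if F.lab R' = 4 ∧ Kᶜ \ Y ⊆ R' ∧ R' ⊆ σ.1 then (1 : ZMod 2) else 0)) * F.rbVec i.1 σ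
              else 0) from sum_congr rfl fun i _ => by rw [if_pos hY0]]
      rw [← hlin Y]
      refine sum_eq_zero fun σ hσ => ?_
      by_cases h : σ.2 = K
      · rw [if_pos h, hsum σ hσ h, mul_zero]
      · rw [if_neg h]
    · exact sum_eq_zero fun i _ => by rw [if_neg hY0, mul_zero]
  -- only `ρ*` survives (minimality of `|Q3|` and distinctness of the `Q3`)
  rw [← Finset.sum_erase_add _ _ (mem_univ s)] at hzero
  rw [show (∑ i ∈ (Finset.univ : Finset ↥R).erase s, g i * ((if F.lab K = 4 ∧ i.1.1 ⊆ K ∧ (i.1.1 ∪ i.1.2)ᶜ ⊆ Kᶜ ∧ F.lab (Kᶜ \ (i.1.1 ∪ i.1.2)ᶜ) = 0 then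
          (∑ R' ∈ (Finset.univ : Finset α).powerset, (if F.lab R' = 4 ∧ i.1.1 ⊆ R' ∧ R' ⊆ K then (1 : ZMod 2) else 0))
          else 0) * ((if (i.1.1 ∪ i.1.2)ᶜ ⊆ Q0 then 1 else 0) + J i))) = 0 from
    sum_eq_zero fun i hi => by
      by_cases hgi : g i = 0
      · rw [hgi, zero_mul]
      · have hiT : i ∈ (Finset.univ : Finset ↥R).filter (fun i => g i ≠ 0) := mem_filter.2 ⟨mem_univ _, hgi⟩
        have hPi : ¬ (i.1.1 ∪ i.1.2)ᶜ ⊆ Q0 := by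
          intro hPi
          have heq : (i.1.1 ∪ i.1.2)ᶜ = Q0 := Finset.eq_of_subset_of_card_le hPi (hmin i hiT)
          exact (mem_erase.1 hi).1 (Subtype.ext (hinj i.1 i.2 s.1 s.2 heq))
        rw [if_neg hPi, hJ0 i, add_zero, mul_zero, mul_zero], zero_add] at hzero
  rw [if_pos ⟨hK4, hsK, hQs, hQs0⟩, hPhi, if_pos (subset_refl _), hJ0 s, add_zero, mul_one, mul_one] at hzero
  exact hgs hzero

/-- **★ FOR SUNFLOWERS WITH A TWO-SIDED JUNK-FREE LOCAL ASSIGNMENT** (this work; unconditional).  Suppose every rainbow `ρ = (Q1,Q2,Q3)` is assigned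
a block `f ρ` which is EITHER a bottom slot whose exact-up-reader junk vanishes against every rainbow assigned to the same block (as in
`ZH_nonneg_of_junkFreeAssignment`), OR a kernel slot (`lab (f ρ) = 4`, `Q1 ⊆ f ρ ⊆ Q1 ∪ Q2`, `lab ((f ρ)ᶜ ∖ Q3) = 0`, `#{R ∈ A : Q1 ⊆ R ⊆ f ρ}` odd)
whose exact-down-reader junk vanishes against every rainbow assigned to the same block; rainbows sharing a bottom block have distinct `Q1`,
rainbows sharing a kernel block distinct `Q3`.  Then `0 ≤ ZH`. [this work] -/
theorem ZH_nonneg_of_biJunkFreeAssignment (f : Finset α × Finset α → Finset α)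
    (hgood : ∀ ρ ∈ F.dem.filter (fun d => F.IsRainbow d),
      (F.lab (f ρ) = 0 ∧ f ρ ⊆ (ρ.1 ∪ ρ.2)ᶜ ∧ F.lab ((f ρ)ᶜ \ ρ.1) = 4 ∧
        (∑ R' ∈ (Finset.univ : Finset α).powerset, (if F.lab R' = 0 ∧ f ρ ⊆ R' ∧ R' ⊆ (ρ.1 ∪ ρ.2)ᶜ then (1 : ZMod 2) else 0)) = 1 ∧
        ∀ ρ' ∈ F.dem.filter (fun d => F.IsRainbow d), f ρ' = f ρ →
          (∑ T ∈ ((f ρ)ᶜ).powerset, (if F.lab T = 1 then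
            (∑ R1 ∈ ((f ρ)ᶜ).powerset, (if F.lab R1 = 4 ∧ ρ.1 ⊆ R1 ∧ T ⊆ (f ρ)ᶜ \ R1 then (1 : ZMod 2) else 0)) *
            (∑ R2 ∈ ((f ρ)ᶜ).powerset, (if F.lab R2 = 4 ∧ ρ'.1 ⊆ R2 ∧ T ⊆ R2 then (1 : ZMod 2) else 0)) else 0)) = 0) ∨
      (F.lab (f ρ) = 4 ∧ ρ.1 ⊆ f ρ ∧ (ρ.1 ∪ ρ.2)ᶜ ⊆ (f ρ)ᶜ ∧ F.lab ((f ρ)ᶜ \ (ρ.1 ∪ ρ.2)ᶜ) = 0 ∧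
        (∑ R' ∈ (Finset.univ : Finset α).powerset, (if F.lab R' = 4 ∧ ρ.1 ⊆ R' ∧ R' ⊆ f ρ then (1 : ZMod 2) else 0)) = 1 ∧
        ∀ ρ' ∈ F.dem.filter (fun d => F.IsRainbow d), f ρ' = f ρ →
          (∑ T ∈ ((f ρ)ᶜ).powerset, (if F.lab T = 3 then
            (∑ R1 ∈ ((f ρ)ᶜ).powerset, (if F.lab R1 = 0 ∧ R1 ⊆ (ρ.1 ∪ ρ.2)ᶜ ∧ (f ρ)ᶜ \ T ⊆ R1 then (1 : ZMod 2) else 0)) *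
            (∑ R2 ∈ ((f ρ)ᶜ).powerset, (if F.lab R2 = 0 ∧ R2 ⊆ (ρ'.1 ∪ ρ'.2)ᶜ ∧ R2 ⊆ T then (1 : ZMod 2) else 0)) else 0)) = 0))
    (hinjB : ∀ ρ ∈ F.dem.filter (fun d => F.IsRainbow d), ∀ ρ' ∈ F.dem.filter (fun d => F.IsRainbow d),
      f ρ = f ρ' → F.lab (f ρ) = 0 → ρ.1 = ρ'.1 → ρ = ρ')
    (hinjA : ∀ ρ ∈ F.dem.filter (fun d => F.IsRainbow d), ∀ ρ' ∈ F.dem.filter (fun d => F.IsRainbow d),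
      f ρ = f ρ' → F.lab (f ρ) = 4 → (ρ.1 ∪ ρ.2)ᶜ = (ρ'.1 ∪ ρ'.2)ᶜ → ρ = ρ') :
    0 ≤ F.ZH := by
  classical
  refine F.ZH_nonneg_of_blockAssignment f (fun ρ hρ => ?_) (fun S hS => ?_)
  · rcases hgood ρ hρ with h | h
    · exact Or.inr h.1
    · exact Or.inl h.1
  · rcases hS with hS4 | hS0
    · refine F.blockIndependent_of_cojunkFree hS4 _ (Finset.filter_subset _ _) (fun ρ hρ => ?_) (fun ρ hρ ρ' hρ' => ?_)
        (fun ρ hρ ρ' hρ' heq => ?_)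
      · obtain ⟨hρr, hρS⟩ := mem_filter.1 hρ
        rcases hgood ρ hρr with h | h
        · rw [hρS, hS4] at h; exact absurd h.1 (by decide)
        · obtain ⟨-, h2, h3, h4, h5, -⟩ := h
          rw [hρS] at h2 h3 h4 h5
          exact ⟨h2, h3, h4, h5⟩
      · obtain ⟨hρr, hρS⟩ := mem_filter.1 hρ
        obtain ⟨hρ'r, hρ'S⟩ := mem_filter.1 hρ'
        rcases hgood ρ hρr with h | h
        · rw [hρS, hS4] at h; exact absurd h.1 (by decide)
        · obtain ⟨-, -, -, -, -, h6⟩ := h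
          have := h6 ρ' hρ'r (by rw [hρ'S, hρS])
          rw [hρS] at this
          exact this
      · obtain ⟨hρr, hρS⟩ := mem_filter.1 hρ
        obtain ⟨hρ'r, hρ'S⟩ := mem_filter.1 hρ'
        exact hinjA ρ hρr ρ' hρ'r (by rw [hρS, hρ'S]) (by rw [hρS]; exact hS4) heq
    · refine F.blockIndependent_of_junkFree hS0 _ (Finset.filter_subset _ _) (fun ρ hρ => ?_) (fun ρ hρ ρ' hρ' => ?_)
        (fun ρ hρ ρ' hρ' heq => ?_)
      · obtain ⟨hρr, hρS⟩ := mem_filter.1 hρ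
        rcases hgood ρ hρr with h | h
        · obtain ⟨-, h2, h3, h4, -⟩ := h
          rw [hρS] at h2 h3 h4
          exact ⟨h2, h3, h4⟩
        · rw [hρS, hS0] at h; exact absurd h.1 (by decide)
      · obtain ⟨hρr, hρS⟩ := mem_filter.1 hρ
        obtain ⟨hρ'r, hρ'S⟩ := mem_filter.1 hρ'
        rcases hgood ρ hρr with h | h
        · obtain ⟨-, -, -, -, h5⟩ := h
          have := h5 ρ' hρ'r (by rw [hρ'S, hρS])
          rw [hρS] at this
          exact this
        · rw [hρS, hS0] at h; exact absurd h.1 (by decide)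
      · obtain ⟨hρr, hρS⟩ := mem_filter.1 hρ
        obtain ⟨hρ'r, hρ'S⟩ := mem_filter.1 hρ'
        exact hinjB ρ hρr ρ' hρ'r (by rw [hρS, hρ'S]) (by rw [hρS]; exact hS0) heq

end Sunflower

end Summit.CriticalPhenomena.PercolationContinuityZ3.Theorems.SunflowerPartition
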